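import Summits.ResolutionOfSingularities.ResolutionOfSingularities.Theorems.FrobeniusClosingSteerTwoBasisDecompositionA
import Literature.FieldTheory.Separability.PDegreeSeparablyGenerated
import Literature.NumberTheory.Transcendental.DerivationExtension
import HarnessLib

/-!
# [OURS · L0 W4.1] K-GG5 (a)(b): finite 2-basis-dual frames of a finitely generated extension of a perfect field of characteristic 2,
# and their unique extension along finite separable towers (chain W4.1 `FrobeniusClosingSteer`, crux stmt-ResolutionOfSingularities-16345;
# custody DEAL #31 (1) → res-D-lib-1; res-L0-w41-plan-1 RULING 192b FILE B; `--supports … --as helper`)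

HONEST FRAMING. OURS kernel file (HIRONAKA-L librarian res-D-lib-1 gen 7), proving EXACTLY AS TYPED by res-L0-w41-tri-3
(`L/res-L0-w41-tri-3/kgg/KGG15_signature.lean` 90f9b13c9a2f0289, statements of res-L0-w41-tri-1 `v621/KGG-signatures.md` 036f669dd3fa960c,
routing `KGG15-review.md` cae09ea12efdbe3c) the two K-GG5 items, over the vocabulary `lamPow` / `IsTwoBasis` of FILE A
(`…TwoBasisDecompositionA`, p549638):

* `isTwoBasis_of_adjoin_eq_top_of_finrank_eq` — THE BRIDGE from the tree's degree-theoretic `2`-basis (`K = K²(λ)`, `[K : K²] = 2^r`,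
  `Literature.FieldTheory.Separability.PDegreeSeparablyGenerated`) to the coordinate form `IsTwoBasis λ`: the `2^r` monomials `λ^ε`
  span a `K²`-subalgebra containing `λ` (`lamPow_mul_lamPow`: `λ^ε·λ^{ε′} = (…)²·λ^{ε+ε′}`), `K²(λ) = K²[λ]` (algebraic), so they span
  `K`, hence are linearly independent by the count, and the coordinates are squares of unique elements (injective Frobenius);
* (a) `exists_twoBasis_dual_derivations` — `κ₀/k` finitely generated, `k` perfect: the tree's separating transcendence basis
  (`exists_finrank_frobenius_eq_pow_card`, Matsumura Thm. 26.5) with its dual derivations (`exists_derivation_dual`) through the bridge;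
* (b) `twoBasis_dual_extends_of_separable` — along a finite separable `κ₁/κ₀`: (i) `isTwoBasis_algebraMap_of_isSeparable` (a `κ₀`-basis
  `u` of `κ₁` has `u²` again a basis — Mathlib `Module.Basis.mapPowExpCharPowOfIsSeparable` —, so `a = ∑_j c_j u_j²`, `c_j = ∑_ε λ^ε d_{εj}²`
  give `a = ∑_ε λ^ε (∑_j d_{εj} u_j)²` in characteristic 2, `sum_lamPow_mul_sq_sum`, uniqueness read off the two bases);
  (ii) `existsUnique_derivation_extends_of_isSeparable` (existence: separable ⇒ formally étale ⇒ formally smooth, Mathlib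
  `Algebra.FormallyEtale.of_isSeparable` + the tree's `Derivation.exists_extension_of_formallySmooth`; uniqueness: the difference of two
  extensions is a `κ₀`-derivation of `κ₁` and `Ω[κ₁⁄κ₀] = 0`, Mathlib `Algebra.FormallyUnramified.of_isSeparable`).

NOTHING in this file is a statement of H. Hironaka's manuscript [Hironaka2017]; OURS chain kernel, candidates not facts. AI-written; AI review
is weaker than expert review. References (orientation only): H. Matsumura, *Commutative Ring Theory*, §25 Thm. 25.3, §26 pp. 201–203,
Thm. 26.5–26.8. [Matsumura1987]
-/

set_option linter.dupNamespace false

namespace Summit.ResolutionOfSingularities.ResolutionOfSingularities.Theorems.SwitchingDichotomy.TwoBasis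

open scoped BigOperators

variable {c r : ℕ}

/-! ## FILE B — K-GG5 (a)(b): finite 2-basis-dual frames and their extension along separable towers -/

section Bridge

variable {L : Type} [Field L] {r : ℕ}

/-- `λ^ε · λ^ε' = (∏_i λ_i^{ε_i ε'_i})² · λ^{ε+ε'}` (exponents added in `Fin 2`). [invented: ours] -/
theorem lamPow_mul_lamPow (lam : Fin r → L) (ε ε' : Fin r → Fin 2) :
    lamPow lam ε * lamPow lam ε' = (∏ i, lam i ^ ((ε i : ℕ) * (ε' i : ℕ))) ^ 2 * lamPow lam (ε + ε') := by
  unfold lamPow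
  rw [← Finset.prod_pow, ← Finset.prod_mul_distrib, ← Finset.prod_mul_distrib]
  refine Finset.prod_congr rfl fun i _ => ?_
  rw [← pow_mul, ← pow_add, ← pow_add]
  congr 1
  have key : ∀ a b : Fin 2, (a : ℕ) + (b : ℕ) = (a : ℕ) * (b : ℕ) * 2 + ((a + b : Fin 2) : ℕ) := by decide
  exact key (ε i) (ε' i)

/-- `λ^{e_i} = λ_i` for the indicator exponent. [invented: ours] -/
theorem lamPow_single (lam : Fin r → L) (i : Fin r) : lamPow lam (Pi.single i 1) = lam i := by
  classical
  unfold lamPow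
  rw [Finset.prod_eq_single i (fun j _ hj => by rw [Pi.single_eq_of_ne hj]; simp)
    (fun h => (h (Finset.mem_univ i)).elim)]
  simp

variable [CharP L 2]

/-- **THE BRIDGE `K = K²(λ)`, `[K : K²] = 2^r` ⟹ `λ` is a finite 2-basis** (Matsumura §26: a p-basis in the degree sense gives
unique coordinates): the `2^r` monomials `λ^ε` span `K` over `K²` (they span a `K²`-subalgebra containing `λ`, and `K²(λ) = K²[λ] = K`)
and are therefore linearly independent (`2^r = [K : K²]`); the coordinates are squares `b_ε²` with `b_ε` unique since Frobenius is
injective. [cite: Matsumura1987, §26 p. 202 and Thm. 26.5] -/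
theorem isTwoBasis_of_adjoin_eq_top_of_finrank_eq (lam : Fin r → L)
    (hadj : IntermediateField.adjoin (frobenius L 2).fieldRange (Set.range lam) = ⊤)
    (hfin : Module.finrank (frobenius L 2).fieldRange L = 2 ^ r) : IsTwoBasis lam := by
  classical
  set F : Subfield L := (frobenius L 2).fieldRange with hF
  let v : (Fin r → Fin 2) → L := fun ε => lamPow lam ε
  -- (1) the `F`-span of the monomials is a subalgebra containing the `λ_i`
  let M : Submodule F L := Submodule.span F (Set.range v)
  have h1 : (1 : L) ∈ M := Submodule.subset_span ⟨0, lamPow_zero lam⟩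
  have hvv : ∀ ε ε', v ε * v ε' ∈ M := by
    intro ε ε'
    have hsq : (∏ i, lam i ^ ((ε i : ℕ) * (ε' i : ℕ))) ^ 2 ∈ F :=
      RingHom.mem_fieldRange.mpr ⟨_, frobenius_def (p := 2) _⟩
    have : v ε * v ε' = (⟨_, hsq⟩ : F) • v (ε + ε') := by
      rw [show v ε * v ε' = _ from lamPow_mul_lamPow lam ε ε']
      rfl
    rw [this]
    exact M.smul_mem _ (Submodule.subset_span ⟨ε + ε', rfl⟩)
  have hmul : ∀ x y, x ∈ M → y ∈ M → x * y ∈ M := by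
    intro x y hx hy
    refine Submodule.span_induction (p := fun y _ => x * y ∈ M) ?_ ?_ ?_ ?_ hy
    · rintro _ ⟨ε', rfl⟩
      refine Submodule.span_induction (p := fun x _ => x * v ε' ∈ M) ?_ ?_ ?_ ?_ hx
      · rintro _ ⟨ε, rfl⟩
        exact hvv ε ε'
      · simp
      · intro a b _ _ ha hb
        rw [add_mul]
        exact M.add_mem ha hb
      · intro c a _ ha
        rw [smul_mul_assoc]
        exact M.smul_mem c ha
    · simp
    · intro a b _ _ ha hb
      rw [mul_add]
      exact M.add_mem ha hb
    · intro c a _ ha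
      rw [mul_smul_comm]
      exact M.smul_mem c ha
  let A : Subalgebra F L := M.toSubalgebra h1 hmul
  -- (2) `A = ⊤`: `K` is finite over `F`, every `λ_i` is algebraic, `K²(λ) = K²[λ] ≤ A`
  have hpos : 0 < Module.finrank F L := by rw [hfin]; positivity
  haveI : Module.Finite F L := Module.finite_of_finrank_pos hpos
  have halg : ∀ x ∈ Set.range lam, IsAlgebraic F x := fun x _ => Algebra.IsAlgebraic.isAlgebraic x
  have hA : A = ⊤ := by
    refine top_le_iff.mp ?_
    rw [← IntermediateField.top_toSubalgebra, ← hadj, IntermediateField.adjoin_toSubalgebra_of_isAlgebraic halg]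
    refine Algebra.adjoin_le ?_
    rintro _ ⟨i, rfl⟩
    change lam i ∈ M
    exact Submodule.subset_span ⟨Pi.single i 1, lamPow_single lam i⟩
  have hspan : ⊤ ≤ Submodule.span F (Set.range v) := by
    intro x _
    have hx : x ∈ A := by rw [hA]; exact Algebra.mem_top
    exact hx
  -- (3) a spanning family of the right size is linearly independent
  have hcard : Fintype.card (Fin r → Fin 2) = Module.finrank F L := by
    rw [Fintype.card_fun, Fintype.card_fin, Fintype.card_fin, hfin]
  have hli : LinearIndependent F v := linearIndependent_of_top_le_span_of_card_eq_finrank hspan hcard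
  -- (4) unique coordinates, which are squares of unique elements
  intro a
  obtain ⟨cf, hcf⟩ := (Submodule.mem_span_range_iff_exists_fun F).mp (hspan (Submodule.mem_top (x := a)))
  have hcoord : ∀ ε, ∃ b : L, b ^ 2 = (cf ε : L) := fun ε => by
    obtain ⟨b, hb⟩ := RingHom.mem_fieldRange.mp (cf ε).2
    exact ⟨b, by rw [← hb, frobenius_def]⟩
  choose b hb using hcoord
  have hrepr : ∀ b' : (Fin r → Fin 2) → L, ∑ ε, lamPow lam ε * b' ε ^ 2 =
      ∑ ε, (⟨b' ε ^ 2, RingHom.mem_fieldRange.mpr ⟨_, frobenius_def (p := 2) _⟩⟩ : F) • v ε := fun b' =>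
    Finset.sum_congr rfl fun ε _ => by rw [Subfield.smul_def, smul_eq_mul, mul_comm]
  refine ⟨b, ?_, ?_⟩
  · -- `a = ∑ λ^ε b_ε²`
    rw [← hcf]
    refine Finset.sum_congr rfl fun ε _ => ?_
    rw [hb, Subfield.smul_def, smul_eq_mul, mul_comm]
  · -- uniqueness
    intro b' hb'
    funext ε
    have h0 : ∑ ε, ((⟨b' ε ^ 2, RingHom.mem_fieldRange.mpr ⟨_, frobenius_def (p := 2) _⟩⟩ : F) - cf ε) • v ε = 0 := by
      simp only [sub_smul, Finset.sum_sub_distrib, hcf, ← hrepr b', ← hb']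
      exact sub_self a
    have hε := Fintype.linearIndependent_iff.mp hli _ h0 ε
    rw [sub_eq_zero] at hε
    have hε' := congrArg (fun c : F => (c : L)) hε
    simp only at hε'
    rw [← hb ε] at hε'
    exact CharTwo.sq_injective hε'

end Bridge

/-! ## K-GG5 (a): a finitely generated extension of a perfect field has a finite 2-basis with dual derivations -/

/-- **K-GG5 (a)** a finitely generated field extension `κ₀` of a PERFECT field `k` of characteristic 2 has a finite 2-basis `λ` (r = trdeg) with DUAL
DERIVATIONS `D i (λ j) = δ_ij` (Matsumura 26.5–26.8, 30.10; derivations kill `κ₀² ⊇ k`). S–M (tri-1). Proof: the tree's separating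
transcendence basis = `2`-basis theorem (`Literature.FieldTheory.Separability.exists_finrank_frobenius_eq_pow_card`) and its dual derivations
(`exists_derivation_dual`), through the bridge `isTwoBasis_of_adjoin_eq_top_of_finrank_eq`. [cite: Matsumura1987, §26 p. 202 and Thm. 26.5] -/
theorem exists_twoBasis_dual_derivations (k κ₀ : Type) [Field k] [PerfectField k] [CharP k 2] [Field κ₀] [Algebra k κ₀]
    (hfg : (⊤ : IntermediateField k κ₀).FG) :
    ∃ (r : ℕ) (lam : Fin r → κ₀) (D : Fin r → Derivation k κ₀ κ₀),
      IsTwoBasis lam ∧ ∀ i j, D i (lam j) = if i = j then 1 else 0 := by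
  classical
  haveI : Algebra.EssFiniteType k κ₀ := IntermediateField.fg_top_iff.mp hfg
  haveI : CharP κ₀ 2 := charP_of_injective_algebraMap (algebraMap k κ₀).injective 2
  obtain ⟨s, hs, hsep, hadj, hfin⟩ :=
    Literature.FieldTheory.Separability.exists_finrank_frobenius_eq_pow_card (k := k) (K := κ₀) 2
  let e := s.equivFin
  have hD := fun i : Fin s.card =>
    Literature.FieldTheory.Separability.exists_derivation_dual (k := k) s hs.1 hsep (e.symm i)
  choose D hD1 hD0 using hD
  refine ⟨s.card, fun i => (e.symm i : κ₀), D, ?_, fun i j => ?_⟩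
  · refine isTwoBasis_of_adjoin_eq_top_of_finrank_eq _ ?_ hfin
    have hrange : Set.range (fun i : Fin s.card => ((e.symm i : s) : κ₀)) = (s : Set κ₀) := by
      ext x
      constructor
      · rintro ⟨i, rfl⟩
        exact (e.symm i).2
      · intro hx
        exact ⟨e ⟨x, hx⟩, by simp⟩
    rw [hrange, hadj]
  · by_cases hij : i = j
    · subst hij
      rw [if_pos rfl]
      exact hD1 i
    · rw [if_neg hij]
      exact hD0 i (e.symm j) fun h => hij (e.symm.injective h).symm

/-! ## K-GG5 (b): extension along a finite separable `κ₁/κ₀` -/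

section Separable

variable (κ₀ κ₁ : Type) [Field κ₀] [Field κ₁] [Algebra κ₀ κ₁]

/-- Bookkeeping in characteristic 2: `∑_ε λ^ε · (∑_j d_{εj} u_j)² = ∑_j (∑_ε λ^ε d_{εj}²) · u_j²`. [invented: ours] -/
theorem sum_lamPow_mul_sq_sum [CharP κ₁ 2] {r n : ℕ} (lam : Fin r → κ₀) (u : Fin n → κ₁)
    (d : (Fin r → Fin 2) → Fin n → κ₀) :
    ∑ ε, lamPow (fun i => algebraMap κ₀ κ₁ (lam i)) ε * (∑ j, d ε j • u j) ^ 2 =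
      ∑ j, algebraMap κ₀ κ₁ (∑ ε, lamPow lam ε * d ε j ^ 2) * u j ^ 2 := by
  have hlam : ∀ ε, lamPow (fun i => algebraMap κ₀ κ₁ (lam i)) ε = algebraMap κ₀ κ₁ (lamPow lam ε) := fun ε => by
    simp [lamPow, map_prod, map_pow]
  have hsq : ∀ ε, (∑ j, d ε j • u j) ^ 2 = ∑ j, algebraMap κ₀ κ₁ (d ε j) ^ 2 * u j ^ 2 := fun ε => by
    rw [CharTwo.sum_sq]
    refine Finset.sum_congr rfl fun j _ => ?_
    rw [Algebra.smul_def, mul_pow]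
  simp only [hlam, hsq, Finset.mul_sum, map_sum, map_mul, map_pow, Finset.sum_mul]
  rw [Finset.sum_comm]
  refine Finset.sum_congr rfl fun j _ => Finset.sum_congr rfl fun ε _ => ?_
  ring

/-- **The image of a 2-basis of `κ₀` is a 2-basis of a finite SEPARABLE extension `κ₁`** (Matsumura 26.7/26.8: `κ₁ = κ₀·κ₁²`,
`[κ₁ : κ₁²] = [κ₀ : κ₀²]`). Proof without degree counting: a `κ₀`-basis `(u_j)` of `κ₁` has `(u_j²)` again a `κ₀`-basis (separability, Mathlib
`Module.Basis.mapPowExpCharPowOfIsSeparable`); writing `a = ∑_j c_j u_j²` and `c_j = ∑_ε λ^ε d_{εj}²` gives `a = ∑_ε λ^ε (∑_j d_{εj} u_j)²` in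
characteristic 2, and uniqueness is read off the two bases. [cite: Matsumura1987, §26 Thm. 26.7] -/
theorem isTwoBasis_algebraMap_of_isSeparable [CharP κ₀ 2] [Algebra.IsSeparable κ₀ κ₁] [FiniteDimensional κ₀ κ₁] {r : ℕ}
    (lam : Fin r → κ₀) (hB : IsTwoBasis lam) : IsTwoBasis (fun i => algebraMap κ₀ κ₁ (lam i)) := by
  classical
  haveI : CharP κ₁ 2 := charP_of_injective_algebraMap (algebraMap κ₀ κ₁).injective 2
  haveI : ExpChar κ₀ 2 := ExpChar.prime Nat.prime_two
  -- a `κ₀`-basis of `κ₁` and its basis of squares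
  let u := Module.finBasis κ₀ κ₁
  let u2 : Module.Basis (Fin (Module.finrank κ₀ κ₁)) κ₀ κ₁ := u.mapPowExpCharPowOfIsSeparable 2 1
  have hu2 : ∀ j, u2 j = u j ^ 2 := fun j => by
    simp [u2, Module.Basis.mapPowExpCharPowOfIsSeparable]
  -- coordinates in the basis `u2` of an element written as in `sum_lamPow_mul_sq_sum`
  have hcoord : ∀ (d : (Fin r → Fin 2) → Fin (Module.finrank κ₀ κ₁) → κ₀) (j),
      u2.repr (∑ ε, lamPow (fun i => algebraMap κ₀ κ₁ (lam i)) ε * (∑ j, d ε j • u j) ^ 2) j =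
        ∑ ε, lamPow lam ε * d ε j ^ 2 := by
    intro d j
    rw [sum_lamPow_mul_sq_sum κ₀ κ₁ lam u d]
    have : ∑ j, algebraMap κ₀ κ₁ (∑ ε, lamPow lam ε * d ε j ^ 2) * u j ^ 2 =
        ∑ j, (∑ ε, lamPow lam ε * d ε j ^ 2) • u2 j :=
      Finset.sum_congr rfl fun j _ => by rw [hu2, Algebra.smul_def]
    rw [this, map_sum]
    simp only [map_smul, Module.Basis.repr_self, Finsupp.smul_single, smul_eq_mul, mul_one, Finsupp.finsetSum_apply,
      Finsupp.single_apply, Finset.sum_ite_eq', Finset.mem_univ, if_true]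
  intro a
  -- existence
  have hc : ∀ j, ∃ d : (Fin r → Fin 2) → κ₀, u2.repr a j = ∑ ε, lamPow lam ε * d ε ^ 2 := fun j => (hB _).exists
  choose d hd using hc
  refine ⟨fun ε => ∑ j, d j ε • u j, ?_, ?_⟩
  · show a = ∑ ε, lamPow (fun i => algebraMap κ₀ κ₁ (lam i)) ε * (∑ j, d j ε • u j) ^ 2
    rw [sum_lamPow_mul_sq_sum κ₀ κ₁ lam u (fun ε j => d j ε)]
    conv_lhs => rw [← u2.sum_repr a]
    refine Finset.sum_congr rfl fun j _ => ?_
    rw [hd j, hu2, Algebra.smul_def]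
  · -- uniqueness: expand each `b ε` in the basis `u` and compare `u2`-coordinates
    intro b hb
    funext ε
    let d' : (Fin r → Fin 2) → Fin (Module.finrank κ₀ κ₁) → κ₀ := fun ε j => u.repr (b ε) j
    have hbε : ∀ ε, b ε = ∑ j, d' ε j • u j := fun ε => (u.sum_repr (b ε)).symm
    have hb' : a = ∑ ε, lamPow (fun i => algebraMap κ₀ κ₁ (lam i)) ε * (∑ j, d' ε j • u j) ^ 2 := by
      rw [hb]
      exact Finset.sum_congr rfl fun ε _ => by rw [← hbε ε]
    have key : ∀ j, d j = fun ε => d' ε j := fun j => by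
      refine (hB _).unique (hd j) ?_
      rw [hb', hcoord d' j]
    rw [hbε ε]
    exact Finset.sum_congr rfl fun j _ => by rw [key j]

variable (k : Type) [Field k] [Algebra k κ₀] [Algebra k κ₁] [IsScalarTower k κ₀ κ₁]

/-- **Unique extension of a `k`-derivation along a finite separable `κ₁/κ₀`**: existence by formal smoothness of separable extensions
(Mathlib `Algebra.FormallyEtale.of_isSeparable`, tree `Derivation.exists_extension_of_formallySmooth`), uniqueness because the difference
of two extensions is a `κ₀`-derivation and `Ω[κ₁⁄κ₀] = 0` (Mathlib `Algebra.FormallyUnramified.of_isSeparable`).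
[cite: Matsumura1987, §25 Thm. 25.3 and §26 p. 202] -/
theorem existsUnique_derivation_extends_of_isSeparable [Algebra.IsSeparable κ₀ κ₁] (D : Derivation k κ₀ κ₀) :
    ∃! D' : Derivation k κ₁ κ₁, ∀ a : κ₀, D' (algebraMap κ₀ κ₁ a) = algebraMap κ₀ κ₁ (D a) := by
  haveI : Algebra.FormallyEtale κ₀ κ₁ := Algebra.FormallyEtale.of_isSeparable κ₀ κ₁
  haveI : Algebra.FormallyUnramified κ₀ κ₁ := Algebra.FormallyUnramified.of_isSeparable κ₀ κ₁
  -- existence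
  let d : Derivation k κ₀ κ₁ := (Algebra.linearMap κ₀ κ₁).compDer D
  obtain ⟨D', hD'⟩ := Literature.NumberTheory.Transcendental.Derivation.exists_extension_of_formallySmooth
    (R := k) (S := κ₀) (T := κ₁) (M := κ₁) d
  refine ⟨D', fun a => by rw [hD' a]; rfl, ?_⟩
  -- uniqueness: `D'' − D'` vanishes on `κ₀`, hence is a `κ₀`-derivation of `κ₁`, hence `0`
  intro D'' hD''
  have hzero : ∀ a : κ₀, (D'' - D') (algebraMap κ₀ κ₁ a) = 0 := fun a => by
    rw [Derivation.sub_apply, hD'' a, hD' a]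
    exact sub_eq_zero.mpr rfl
  let δ : Derivation κ₀ κ₁ κ₁ :=
    { toFun := fun x => (D'' - D') x
      map_add' := fun x y => map_add _ x y
      map_smul' := fun a x => by
        simp only [RingHom.id_apply, Algebra.smul_def]
        rw [Derivation.leibniz, hzero a, smul_zero, add_zero, smul_eq_mul]
      map_one_eq_zero' := (D'' - D').map_one_eq_zero
      leibniz' := fun x y => (D'' - D').leibniz x y }
  have hδ : ∀ x, δ x = 0 := fun x => by
    have h := δ.liftKaehlerDifferential_comp_D x
    rw [Subsingleton.elim (KaehlerDifferential.D κ₀ κ₁ x) 0, map_zero] at h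
    exact h.symm
  ext x
  have hx : (D'' - D') x = 0 := hδ x
  rwa [Derivation.sub_apply, sub_eq_zero] at hx

end Separable

/-- **K-GG5 (b)** along a FINITE SEPARABLE extension `κ₁/κ₀` the image of a finite 2-basis stays a 2-basis and each dual derivation extends UNIQUELY
(`κ₁ = κ₁²·κ₀`, `[κ₁ : κ₁²] = [κ₀ : κ₀²]`; derivations extend uniquely along separable algebraic extensions — the duality `D i (λ j) = δ_ij` is then
inherited by the extensions, so it is not a binder here). S–M (tri-1). [cite: Matsumura1987, §26 Thm. 26.7 and §25 Thm. 25.3] -/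
theorem twoBasis_dual_extends_of_separable (k κ₀ κ₁ : Type) [Field k] [CharP k 2] [Field κ₀] [Field κ₁] [Algebra k κ₀]
    [Algebra κ₀ κ₁] [Algebra k κ₁] [IsScalarTower k κ₀ κ₁] [Algebra.IsSeparable κ₀ κ₁] [FiniteDimensional κ₀ κ₁]
    (lam : Fin r → κ₀) (hB : IsTwoBasis lam) (D : Fin r → Derivation k κ₀ κ₀) :
    IsTwoBasis (fun i => algebraMap κ₀ κ₁ (lam i)) ∧
      ∀ i, ∃! D' : Derivation k κ₁ κ₁, ∀ a : κ₀, D' (algebraMap κ₀ κ₁ a) = algebraMap κ₀ κ₁ (D i a) := by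
  haveI : CharP κ₀ 2 := charP_of_injective_algebraMap (algebraMap k κ₀).injective 2
  exact ⟨isTwoBasis_algebraMap_of_isSeparable κ₀ κ₁ lam hB,
    fun i => existsUnique_derivation_extends_of_isSeparable κ₀ κ₁ k (D i)⟩

/-! ## APPEND §K1′-shape (2026-08-27 17:5xZ): the K-GG5 producer in the binder shape of the F♭_λ bridge / K1′
(`…FrobeniusClosingSteerFreeChainBoundPBasis.milnorLengthPlus_completion_ge`, res-L0-w41-stub-2 p551861:
`(γ : Fin r → κ) (D : Fin r → Derivation ℤ κ κ) (hdual : ∀ l l', D l (γ l') = if l' = l then 1 else 0) (hgen : pAdjoin 2 (Set.range γ) = ⊤)`) -/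

section PFrame

open Literature.FieldTheory.Separability

/-- A 2-basis generates the field over the squares: `IsTwoBasis λ ⟹ K²(λ) = K` (`pAdjoin 2 (range λ) = ⊤`; every element is
`∑ λ^ε b_ε²`). [invented: ours] -/
theorem pAdjoin_eq_top_of_isTwoBasis {κ : Type} [Field κ] [CharP κ 2] {r : ℕ} (lam : Fin r → κ) (hB : IsTwoBasis lam) :
    pAdjoin 2 (Set.range lam) = ⊤ := by
  refine eq_top_iff.mpr fun a _ => ?_
  obtain ⟨b, hb, -⟩ := hB a
  rw [hb]
  refine Subfield.sum_mem _ fun ε _ => Subfield.mul_mem _ ?_ (pow_mem_pAdjoin _ _)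
  unfold lamPow
  exact Subfield.prod_mem _ fun i _ => Subfield.pow_mem _ (subset_pAdjoin _ (Set.mem_range_self i)) _

/-- **The K-GG5 frame in K1′'s binder shape**: from a finite 2-basis `λ` with dual `k`-derivations `D`, the `ℤ`-derivations
`D.restrictScalars ℤ` satisfy `hdual` (K1′'s index convention) and `hgen : pAdjoin 2 (range λ) = ⊤`. [invented: ours] -/
theorem pFrame_of_isTwoBasis {κ : Type} [Field κ] [CharP κ 2] {k : Type} [CommRing k] [Algebra k κ] {r : ℕ}
    (lam : Fin r → κ) (hB : IsTwoBasis lam) (D : Fin r → Derivation k κ κ)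
    (hD : ∀ i j, D i (lam j) = if i = j then 1 else 0) :
    (∀ l l', (D l).restrictScalars ℤ (lam l') = if l' = l then 1 else 0) ∧ pAdjoin 2 (Set.range lam) = ⊤ := by
  refine ⟨fun l l' => ?_, pAdjoin_eq_top_of_isTwoBasis lam hB⟩
  rw [Derivation.restrictScalars_apply, hD l l']
  simp only [eq_comm]

/-- **K-GG5 (a) in K1′'s binder shape** — the PRODUCER for res-L0-w41-stub-2's F♭_λ bridge (`milnorLengthPlus_completion_ge` /
`not_eternal_free_rational_chain`, p551861) and stub-3's I″: a finitely generated extension `κ₀` of a perfect field `k` of characteristic 2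
carries `(γ : Fin r → κ₀) (D : Fin r → Derivation ℤ κ₀ κ₀)` with `D l (γ l') = δ_{l l'}` and `pAdjoin 2 (range γ) = ⊤` (and `γ` is a 2-basis).
[cite: Matsumura1987, §26 p. 202 and Thm. 26.5] -/
theorem exists_pFrame_of_fg (k κ₀ : Type) [Field k] [PerfectField k] [CharP k 2] [Field κ₀] [Algebra k κ₀] [CharP κ₀ 2]
    (hfg : (⊤ : IntermediateField k κ₀).FG) :
    ∃ (r : ℕ) (γ : Fin r → κ₀) (D : Fin r → Derivation ℤ κ₀ κ₀),
      IsTwoBasis γ ∧ (∀ l l', D l (γ l') = if l' = l then 1 else 0) ∧ pAdjoin 2 (Set.range γ) = ⊤ := by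
  obtain ⟨r, lam, D, hB, hD⟩ := exists_twoBasis_dual_derivations k κ₀ hfg
  obtain ⟨hdual, hgen⟩ := pFrame_of_isTwoBasis lam hB D hD
  exact ⟨r, lam, fun l => (D l).restrictScalars ℤ, hB, hdual, hgen⟩

/-- … and its transport to a finite separable extension `κ₁/κ₀` in the same shape (K-GG5 (b)): the image frame with the UNIQUE
extensions of the dual derivations. [cite: Matsumura1987, §26 Thm. 26.7 and §25 Thm. 25.3] -/
theorem exists_pFrame_of_isSeparable (k κ₀ κ₁ : Type) [Field k] [CharP k 2] [Field κ₀] [Field κ₁] [Algebra k κ₀]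
    [Algebra κ₀ κ₁] [Algebra k κ₁] [IsScalarTower k κ₀ κ₁] [Algebra.IsSeparable κ₀ κ₁] [FiniteDimensional κ₀ κ₁] [CharP κ₁ 2]
    {r : ℕ} (lam : Fin r → κ₀) (hB : IsTwoBasis lam) (D : Fin r → Derivation k κ₀ κ₀)
    (hD : ∀ i j, D i (lam j) = if i = j then 1 else 0) :
    ∃ D' : Fin r → Derivation ℤ κ₁ κ₁,
      IsTwoBasis (fun i => algebraMap κ₀ κ₁ (lam i)) ∧
        (∀ l l', D' l (algebraMap κ₀ κ₁ (lam l')) = if l' = l then 1 else 0) ∧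
          (∀ l (a : κ₀), D' l (algebraMap κ₀ κ₁ a) = algebraMap κ₀ κ₁ (D l a)) ∧
            pAdjoin 2 (Set.range fun i => algebraMap κ₀ κ₁ (lam i)) = ⊤ := by
  obtain ⟨hB1, hext⟩ := twoBasis_dual_extends_of_separable k κ₀ κ₁ lam hB D
  choose D1 hD1 using fun i => (hext i).exists
  have hdual1 : ∀ i j, D1 i (algebraMap κ₀ κ₁ (lam j)) = if i = j then 1 else 0 := fun i j => by
    rw [hD1 i, hD i j]
    split_ifs <;> simp
  obtain ⟨hdual, hgen⟩ := pFrame_of_isTwoBasis (fun i => algebraMap κ₀ κ₁ (lam i)) hB1 D1 hdual1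
  exact ⟨fun l => (D1 l).restrictScalars ℤ, hB1, hdual, fun l a => by rw [Derivation.restrictScalars_apply, hD1 l a], hgen⟩

end PFrame

end Summit.ResolutionOfSingularities.ResolutionOfSingularities.Theorems.SwitchingDichotomy.TwoBasis
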